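import Mathlib
import Summits.ValiantsHypothesis.ValiantsHypothesis.Theorems.NewtonUnitEquationsTwoProductsFormalLogLinearisationDefs
import Summits.ValiantsHypothesis.ValiantsHypothesis.Theorems.NewtonUnitEquationsTwoProductsPlanarCrossCount

/-! crit-3 VERDICT #6b PRICE P2 (val-idea-8 g0): the random-side law of crux idea `coincidence-dichotomy` as a TYPED Prop at `m = 2`
(p3 g13 NOTE §13.4(b) "Turán law" made a conjecture): per cell, #visible ≤ c·(1 + √Coin(E)), where Coin(E) counts the additive
coincidences of the tail support E = non-trivial solutions of a+b = a'+b' in E plus incidences a+b = z ∈ E.  Attackable by cdisprove /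
triage: a family with visible ≫ √Coin in one cell refutes it; p3's staircase has visible = K+1, Coin ≥ K(K+1)/2 (consistent).

CAVEATS recorded at filing (val-idea-8 g0, 03:5xZ): (a) `coin` counts DEPTH-2 relations only; the proved unique-representation theorem
(`planarSlotBound_charged` + `planarCount_cell`, touched = ∅) needs independence up to the READ depth (≤ 3 at m = 2), so `coin = 0` does not by itself
make every slot member untouched — a depth-3 variant `coin₃` may be the right quantity; (b) the COMBINATORIAL per-cell capacity (adversarial supp W ⊆ E ∪ (E+E),
realisability ignored) is NOT bounded at coin = 0: SA found capacity 3,3,4,4,5,5 for s = 4..10 (kit/cell_capacity*.py), so the law is algebraic, not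
combinatorial — consistent with the slot theorem (zero patterns of the rank-≤ 2m depth-2 coefficient matrix sym(u₁⊗u₂) − sym(v₁⊗v₂) are unions of few
rectangles); (c) reduced P1 run (realisable W, coin ≤ 1, t = 6, coefficients ±{1,2}, 13×13 grid, 40×1500 SA steps): max visible per cell = 2 ≤ 2m. -/

namespace Summit.ValiantsHypothesis.ValiantsHypothesis.Cruxes.TwoProducts.CoincidenceDichotomy

open MvPolynomial
open Summit.ValiantsHypothesis.ValiantsHypothesis.Theorems.NewtonUnitEquations.TwoProducts.FormalLogLinearisation
open Summit.ValiantsHypothesis.ValiantsHypothesis.Theorems.NewtonUnitEquations.TwoProducts.PlanarCell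

/-- Additive coincidence count of a finite planar set: ordered solutions of `a + b = a' + b'` with `{a,b} ≠ {a',b'}`
(additive-energy surplus) plus incidences `a + b = z` with `a, b, z ∈ E` (first-order points hit by second-order ones). -/
noncomputable def coin (E : Finset Expo) : ℕ :=
  (((E ×ˢ E) ×ˢ (E ×ˢ E)).filter (fun q => q.1.1 + q.1.2 = q.2.1 + q.2.2 ∧ q.1 ≠ q.2 ∧ q.1 ≠ (q.2.2, q.2.1))).card +
  (((E ×ˢ E) ×ˢ E).filter (fun q => q.1.1 + q.1.2 = q.2)).card

/-- **P2 — `VisibleLeSqrtCoin` (m = 2 random-side law, conjectural).**  Same binder shape as `PlanarCellBound` (p596451) at `m = 2`: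
in one weight-order cell `R` of the tail support, the number of log-visible strict tops is at most `c · (1 + √coin(E))`. -/
def VisibleLeSqrtCoin : Prop :=
  ∃ c : ℕ, ∀ (t : ℕ), 2 ≤ t → ∀ (u v : Fin 2 → MvPolynomial (Fin 2) ℂ),
    (∀ j, coeff 0 (u j) = 0 ∧ (u j).support.card ≤ t) → (∀ j, coeff 0 (v j) = 0 ∧ (v j).support.card ≤ t) →
    ∀ (R : Expo → Expo → Prop) (S : Finset Expo),
      (∀ l ∈ S, ∃ ξ : Fin 2 → ℝ, ValidWeight u v ξ ∧ IsStrictTop ξ (logSupport u v) l ∧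
        ∀ e ∈ tailSupport u v, ∀ e' ∈ tailSupport u v, (R e e' ↔ wt ξ e ≤ wt ξ e')) →
      S.card ≤ c * (1 + Nat.sqrt (coin (tailSupport u v)))

/-- The general-`m` form the engine would need (random side): `c` may grow like `2^{O(m)}` but not with `t`. -/
def VisibleLeSqrtCoinM : Prop :=
  ∃ a c : ℕ, ∀ (m t : ℕ), 2 ≤ t → ∀ (u v : Fin m → MvPolynomial (Fin 2) ℂ),
    (∀ j, coeff 0 (u j) = 0 ∧ (u j).support.card ≤ t) → (∀ j, coeff 0 (v j) = 0 ∧ (v j).support.card ≤ t) →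
    ∀ (R : Expo → Expo → Prop) (S : Finset Expo),
      (∀ l ∈ S, ∃ ξ : Fin 2 → ℝ, ValidWeight u v ξ ∧ IsStrictTop ξ (logSupport u v) l ∧
        ∀ e ∈ tailSupport u v, ∀ e' ∈ tailSupport u v, (R e e' ↔ wt ξ e ≤ wt ξ e')) →
      S.card ≤ 2 ^ (a * m) * c * (1 + Nat.sqrt (coin (tailSupport u v)))

end Summit.ValiantsHypothesis.ValiantsHypothesis.Cruxes.TwoProducts.CoincidenceDichotomy
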